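import Summits.QuantumFields.YangMills.Theorems.BalabanUVNodesK0TopSocketOfThm1RegText
import Literature.MathematicalPhysics.QuantumFieldTheory.Balaban1983to89.B11Thm1ExistsUniqueCoP7MG
import Literature.MathematicalPhysics.QuantumFieldTheory.Balaban1983to89.B11Thm1CarrierTLevelZero

/-!
# K0⁷ ∕ N07 ∕ N12 — THE (T1) SOCKET, EXISTENCE ∕ UNIQUENESS HALF, AND n07-a's THEOREM-1-AT-OBJECTS SLOT `hT1` FROM THE TWO [15] TEXTS OF THE K0∕N12 LANES: N12's displayed
# `VariationalThm1EUSepCoP7MG` ([15] Thm 1, existence ∕ uniqueness over class (6) on the support, uniqueness modulo tower-central gauges) read at the TOP index IS «(0.21) over `𝔘_k(ε₀)` at a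
# `δ`-regular datum has a minimiser, unique up to a RESIDUAL gauge»; with file 5's (8)-socket this gives `hT1` VERBATIM at every member inside the level guard

Cell `pub-ymgap`, width seat `pub-ymgap-dag-n07-w3` (g20; N07 [B11] ∕ K0⁷ junction).  `--kind proof --supports stmt-QuantumFields-20541 --as helper`, COUNT-NEUTRAL.  NEW leaf;
theorems only — 0 `def`, 0 `sorry`, 0 `instance`, 0 `notation`.  Imports this seat's file 5 `…K0TopSocketOfThm1RegText` (the (8)-half: top index, class (6)-top = `InUkClassB11`, (7) at
the top, the guard), N12's Literature sentence `B11Thm1ExistsUniqueCoP7MG` (dag-n12-c g30; a `Prop`, never asserted, NO producer in the tree) and `B11Thm1CarrierTLevelZero` (`inUkClassB11_mono`).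
[15] = [Balaban1985Variational]; [III] = [Balaban1988Convergent]; [I] = [Balaban1987RG1].

WHY.  CRIT-1's (T1) socket has three pieces (sheet `CRIT-1-R2-seat3-radius-collapse-g32.md`): (T1a) class (6) vs `bgReg`, (T1b) datum∕fibre match, (T1c) existence.  File 5 did (T1a)∕(T1b)
and the (8)-regularity half; THIS FILE does (T1c) and the uniqueness clause (6), from N12's displayed sentence, and assembles n07-a's `hT1` — the N07 slot every N09∕N21∕K0 door displays — from
the two K0∕N12 texts.  At the top index: the (b)-datum (7) `Sect2.DataSmall7PTop` holds as soon as `|∂W_k − 1| < δ_k` (§1; the `Γ₀`- and `Γ_n`-ranges are empty, the scale-`k` (7) field is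
`W_k`); the (2.2) determining set is `atScale k` so `IsMinimizer … (genSet s.Ω k) W` is `IsBackground … k (W k)` (node00 `isMinimizer_genSet_top_iff`); the class is `{InUkClassB11 … ε₀}`
(file 5 §3∕§8); and the uniqueness conclusion «`U₂ = U₁^u` with `toMS u n` equal and central at the two ends of every constrained bond» reads, at `n = k` (ALL level-`k` bonds), «`u` is
ONE central constant `z` at the `k`-centres» (the `k`-torus is connected by unit steps, §2 `eq_of_forall_bond_eq`), and `z⁻¹·u` is RESIDUAL with the same action (`z` central) — so
`OrbitRel k U₁ U₂` (§2 `orbitRel_of_towerCentral`).  §3 ★★★ `exists_unique_isBackground_inUkClassB11_of_thm1EUSepCoP7MG`: the EU text ⟹ for `(K, k)` inside the guard, `0 < δ ≤ a₁`,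
`B₃δ ≤ ε₀ ≤ a₀`, `V` `δ`-regular: a minimiser over `𝔘_k(ε₀)` at `V` EXISTS and any two are residual-gauge related.  §4 ★★★★ `thm1Objects_of_texts`: n07-a's `hT1` at `(K, k)` (ceilings
`a₀, a₁`, constant `B₃`) — VERBATIM the hypothesis shape of dag-n21-c's `plaqSmall_minimiser_of_thm1_objects` ∕ this seat's doors — from the (8)-text + the EU-text inside the level guard;
§5 `thm1Objects_of_thm1EU_SU2`: at `N = 2` the (8)-text is a tree theorem (file 5 §7), so `hT1` inside the (large) guard costs the EU text ALONE.

HONEST FRAMING (binding).  By-name composition + the torus-connectivity lemma; NO β estimate; nothing of Bałaban's asserted.  The EU text is a DISPLAYED hypothesis with NO producer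
(its `k = 0` edition is refuted in the tree — `B15Prop1Thm1LetterLengthZero`, the centre twist — hence the `0 < k` guard, respected here); the (8)-text is a theorem at `N = 2` only inside the
S1c witness's level guard (`c₀ ≥ m + 48`): NOTHING here supplies `hT1` at the levels the K0∕N09 doors read; N07 NOT discharged; stub 2′ OPEN; K0⁷ stmt-QuantumFields-20541 NOT closed;
COUNT 8∕28 · K 1∕4 UNMOVED; R4 = the CONDITIONAL finite-𝕋⁴ rung `BalabanLadder.UV` at fixed `ε = L^(−K)` only — NOT continuum ∕ ℝ⁴ ∕ OS; the Yang–Mills mass gap (Clay) is NOT proved by any of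
this.  Standard axioms only.
-/

noncomputable section

open MeasureTheory Set
open scoped Matrix.Norms.L2Operator

namespace Summit.QuantumFields.YangMills.BalabanUVNodes.K0TopSocketOfThm1EUText

open Literature.MathematicalPhysics.QuantumFieldTheory.Balaban1983to89
open Literature.MathematicalPhysics.QuantumFieldTheory.Balaban1983to89.Node00
open Literature.MathematicalPhysics.QuantumFieldTheory.Balaban1983to89.T4Continuum
open B15DeterminingSets B15DeterminingSetsB B14.Eq218Concrete GaugeField
open B12GaugeOrbits021 (OrbitRel IsResidual)
open B16Sect1Backgrounds (toMS)
open B11Thm1ExistsUniqueCoP7MG (VariationalThm1EUSepCoP7MG)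
open B11Thm1CarrierTLevelZero (inUkClassB11_mono)
open Summit.QuantumFields.YangMills.Theorems.K0TopIndexWrapGeometry (exists_seq_top)
open Summit.QuantumFields.YangMills.BalabanUVNodes.N07Thm1ScaledInterfaceInstance (RkOfRecord_zero_r)
open Summit.QuantumFields.YangMills.BalabanUVNodes.K0TopSocketOfThm1RegText

variable {F : T4Family} {N : ℕ} [NeZero N]

/-! ## §1  The (b)-datum (7) at a top index is `|∂W_k − 1| < δ_k` -/

/-- **(b)-DATUM (7) AT A TOP INDEX** (`Sect2.DataSmall7PTop`, the data row of the EU text): the `Γ₀`-∕`Γ_n`-ranges (`n < k`) are void and at scale `k` the (7) field is `W_k` (every level-`k`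
bond meets `Γ_k = T`). [cite: Balaban1985Variational, (7) p.278; Balaban1988Convergent, (2.2) p.255, (2.10) p.256] -/
theorem dataSmall7PTop_top (K : ℕ) {Ω : ℕ → Set (Site (F.P K) 0)} {k : ℕ} (hk : 1 ≤ k) (hΩ : ∀ j, 1 ≤ j → j ≤ k → Ω j = Set.univ)
    {δ : ℕ → ℝ} {W : MSField (F.P K) (SU N)} (hW : PlaqSmall (δ k) (W k)) :
    Sect2.DataSmall7PTop (avOfRecord F N K) Ω Set.univ k δ W := by
  have hgs : genSet Ω k = atScale k := genSet_eq_atScale_of_top Ω hk hΩ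
  refine ⟨?_, ?_⟩
  · intro p hp
    have h1 : p ∈ B8Eq17ClassAkV1.plaqsOf (genSet Ω k 0) := Sect2.printedPlaqs_subset_plaqsOf Ω k 0 (Sect2.printedPlaqsTop_subset Ω Set.univ k hp)
    rw [hgs] at h1
    simp [atScale, (show (0 : ℕ) ≠ k by omega), B8Eq17ClassAkV1.plaqsOf] at h1
  · intro m hm p hp
    have h1 : p ∈ B8Eq17ClassAkV1.plaqsOf (genSet Ω k (m + 1)) := Sect2.printedPlaqs_subset_plaqsOf Ω k (m + 1) hp
    rcases hm.eq_or_lt with h | h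
    · subst h
      have hb : ∀ b : PBond (F.P K) (m + 1), b ∈ bondsOf (genSet Ω (m + 1) (m + 1)) := fun b => by
        rw [hgs]; simp [atScale, B8Eq17ClassAkV1.bondsOf_univ]
      have hfield : Sect2.mixedField (avOfRecord F N K) (genSet Ω (m + 1) (m + 1)) (W (m + 1)) (W m) = W (m + 1) :=
        funext fun b => Sect2.mixedField_of_mem _ _ _ (hb b)
      rw [hfield]
      exact hW p
    · rw [hgs] at h1
      simp [atScale, (show m + 1 ≠ k by omega), B8Eq17ClassAkV1.plaqsOf] at h1

/-! ## §2  Torus connectivity: bondwise-constant site functions are constant; tower-central gauges at the top act as residual ones -/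

omit [NeZero N] in
/-- **A SITE FUNCTION EQUAL AT THE TWO ENDS OF EVERY BOND IS CONSTANT** (the torus `T^{(k)} = (ℤ∕N_k)^d` is connected by unit steps). [folklore] -/
theorem eq_of_forall_bond_eq {P : Params} {j : ℕ} {M : Type*} (f : Site P j → M) (h : ∀ b : PBond P j, f b.src = f b.tgt) (x y : Site P j) : f x = f y := by
  have hs : ∀ (μ : Fin P.d) (x : Site P j), f (Site.shift x μ) = f x := fun μ x => (h ⟨x, μ⟩).symm
  have ha : ∀ (μ : Fin P.d) (x : Site P j) (n : ℕ), f (Function.update x μ (x μ + (n : ZMod (P.sitesPerDir j)))) = f x := by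
    intro μ x n
    induction n with
    | zero => rw [Nat.cast_zero, add_zero, Function.update_eq_self]
    | succ n ih =>
      have e : Function.update x μ (x μ + ((n + 1 : ℕ) : ZMod (P.sitesPerDir j))) =
          Site.shift (Function.update x μ (x μ + (n : ZMod (P.sitesPerDir j)))) μ := by
        unfold Site.shift
        rw [Function.update_idem, Function.update_self, Nat.cast_succ, add_assoc]
      rw [e, hs, ih]
  have hb : ∀ (μ : Fin P.d) (x : Site P j) (v : ZMod (P.sitesPerDir j)), f (Function.update x μ v) = f x := by
    intro μ x v
    have := ha μ x (v - x μ).val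
    rwa [ZMod.natCast_zmod_val, add_sub_cancel] at this
  have hc : ∀ (s : Finset (Fin P.d)) (x y : Site P j), (∀ μ, μ ∉ s → x μ = y μ) → f x = f y := by
    intro s
    induction s using Finset.induction_on with
    | empty =>
      intro x y hxy
      rw [show x = y from funext fun μ => hxy μ (by simp)]
    | @insert μ₀ s hμ₀ ih =>
      intro x y hxy
      rw [← hb μ₀ x (y μ₀)]
      apply ih
      intro μ hμ
      by_cases hμμ : μ = μ₀
      · subst hμμ; simp
      · rw [Function.update_of_ne hμμ]; exact hxy μ (by simp [hμμ, hμ])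
  exact hc Finset.univ x y (fun μ hμ => absurd (Finset.mem_univ μ) hμ)

omit [NeZero N] in
/-- **A TOWER-CENTRAL GAUGE AT THE TOP IS RESIDUAL UP TO ITS CENTRAL CONSTANT**: if `u`'s images at the `k`-centres agree across every level-`k` bond and are central, then `U^u` lies on
the RESIDUAL orbit of `U` (`OrbitRel k`): `u ∘ embIter k ≡ z` central (§2), and `z⁻¹·u` is residual with `(z⁻¹·u)·U = u·U`. [cite: Balaban1985Variational, (4) p.278; Balaban1987RG1, (0.21) p.256] -/
theorem orbitRel_of_towerCentral {P : Params} {G : Type*} [GaugeGroup G] {k : ℕ} (u : GaugeTransf P 0 G) (U : GaugeField P 0 G)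
    (h : ∀ b : PBond P k, toMS u k b.src = toMS u k b.tgt ∧ ∀ g : G, toMS u k b.src * g = g * toMS u k b.src) :
    OrbitRel k U (gaugeAct u U) := by
  classical
  -- the central constant (any `k`-centre will do; the torus of level `k` is non-empty)
  obtain ⟨y₀⟩ : Nonempty (Site P k) := inferInstance
  have hconst : ∀ y : Site P k, u (embIter k y) = u (embIter k y₀) := fun y =>
    eq_of_forall_bond_eq (fun y => u (embIter k y)) (fun b => (h b).1) y y₀
  have hcentral : ∀ g : G, u (embIter k y₀) * g = g * u (embIter k y₀) := fun g => (h ⟨y₀, ⟨0, P.hd⟩⟩).2 g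
  refine ⟨fun x => (u (embIter k y₀))⁻¹ * u x, fun y => by simp [hconst y], funext fun b => ?_⟩
  simp only [gaugeAct, mul_inv_rev, inv_inv]
  -- `z⁻¹ u(src) U (u(tgt))⁻¹ z = u(src) U u(tgt)⁻¹` because `z` is central
  have hz := hcentral
  calc u b.src * U b * (u b.tgt)⁻¹
      = (u (embIter k y₀))⁻¹ * (u (embIter k y₀) * (u b.src * U b * (u b.tgt)⁻¹)) := by rw [inv_mul_cancel_left]
    _ = (u (embIter k y₀))⁻¹ * ((u b.src * U b * (u b.tgt)⁻¹) * u (embIter k y₀)) := by rw [hz]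
    _ = (u (embIter k y₀))⁻¹ * u b.src * U b * ((u b.tgt)⁻¹ * u (embIter k y₀)) := by simp only [mul_assoc]

/-! ## §3  The EU text at the top index: existence and residual uniqueness over `𝔘_k(ε₀)` in `IsBackground` currency -/

section Socket

variable (F N)

/-- ★★★ **THE (T1) SOCKET, EXISTENCE ∕ UNIQUENESS HALF.**  Let N12's [15] sentence `VariationalThm1EUSepCoP7MG F N A‴(c, c₀, c₁) B₃ a₀ a₁` hold.  Then at every member `(K, k)` inside the level
guard (`1 ≤ k`, `k + c₀ ≤ m + K`, `k + c₁ ≤ m + K`), for `0 < δ ≤ a₁`, `B₃δ ≤ ε₀ ≤ a₀` (`0 ≤ B₃`) and every `δ`-regular datum `V`: (i) the one-scale problem (0.21) over [15] (2)'s space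
`𝔘_k(ε₀)` (`{InUkClassB11 F N K k ε₀}`) at `V` HAS a minimiser; (ii) any two minimisers lie on ONE RESIDUAL ORBIT (`OrbitRel k`).  Read off the text at dag-n21-c's separated top index
(`ν.M₁ := max c 1`, `ν.r := 0`, `M := L^{c₁}`, `g := 0`, `δ_n := δ`, datum `W := V` at scale `k` and `1` elsewhere).  CONDITIONAL on the EU text; nothing of Bałaban's asserted.
[cite: Balaban1985Variational, Thm 1 p.279, (2)–(7) p.278, (4) p.278; Balaban1988Convergent, (2.2) p.255, (2.12) p.256, (2.18) p.257; Balaban1987RG1, (0.21) p.256, (1.1) p.260] -/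
theorem exists_unique_isBackground_inUkClassB11_of_thm1EUSepCoP7MG {c c₀ c₁ : ℕ} {B₃ a₀ a₁ : ℝ} (hB₃ : 0 ≤ B₃)
    (hEU : VariationalThm1EUSepCoP7MG F N
      (fun ν M g K k _s => c ≤ ν.M₁ ∧ k + c₀ ≤ F.m + K ∧ F.L ^ c₁ ∣ M ∧
        ∀ i, 1 ≤ i → i ≤ k → dCubeSide (F.P K).L M (RkOfRecord (F.P K).L ν.r (g i)) i ∣ (F.P K).sitesPerDir 0) B₃ a₀ a₁)
    {K k : ℕ} (hk : 1 ≤ k) (hc₀ : k + c₀ ≤ F.m + K) (hc₁ : k + c₁ ≤ F.m + K)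
    {ε₀ δ : ℝ} (hδ : 0 < δ) (hδa : δ ≤ a₁) (hBδ : B₃ * δ ≤ ε₀) (hε : ε₀ ≤ a₀)
    {V : GaugeField (F.P K) k (SU N)} (hV : PlaqSmall δ V) :
    (∃ U₀ : GaugeField (F.P K) 0 (SU N), IsBackground (avOfRecord F N K) {U | InUkClassB11 F N K k ε₀ U} k V U₀) ∧
      ∀ U₁ U₂ : GaugeField (F.P K) 0 (SU N), IsBackground (avOfRecord F N K) {U | InUkClassB11 F N K k ε₀ U} k V U₁ →
        IsBackground (avOfRecord F N K) {U | InUkClassB11 F N K k ε₀ U} k V U₂ → OrbitRel k U₁ U₂ := by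
  -- the numerics carrier, the cube letter, the couplings, the separated top index, the guard (as in file 5)
  obtain ⟨ν, hνM₁, hνr⟩ : ∃ ν : Stage7Numerics, ν.M₁ = max c 1 ∧ ν.r = 0 :=
    ⟨{ M₁ := max c 1, M₂ := 0, r := 0, p₀ := 0, A₀ := 0, logσ₀ := 0, εreg := 0, ε₀ := 0 }, rfl, rfl⟩
  have hM₁pos : 0 < ν.M₁ := by rw [hνM₁]; exact lt_of_lt_of_le zero_lt_one (le_max_right _ _)
  have hL1 : 1 ≤ F.L := F.hL.2.le
  have hM : 1 ≤ F.L ^ c₁ := Nat.one_le_pow _ _ (by omega)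
  obtain ⟨s, htop, hsep⟩ := exists_seq_top (F := F) ν hM (fun _ => (0 : ℝ)) K k
  have hadm : c ≤ ν.M₁ ∧ k + c₀ ≤ F.m + K ∧ F.L ^ c₁ ∣ F.L ^ c₁ ∧
      ∀ i, 1 ≤ i → i ≤ k → dCubeSide (F.P K).L (F.L ^ c₁) (RkOfRecord (F.P K).L ν.r ((fun _ : ℕ => (0 : ℝ)) i)) i ∣ (F.P K).sitesPerDir 0 := by
    refine ⟨by rw [hνM₁]; exact le_max_left _ _, hc₀, dvd_rfl, fun i _ hi => ?_⟩
    rw [hνr, RkOfRecord_zero_r]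
    exact dCubeSide_dvd_sitesPerDir K (by omega)
  have hε0 : 0 ≤ ε₀ := (mul_nonneg hB₃ hδ.le).trans hBδ
  have hsup : suppDomOfRecord F ν K s.Ω = Set.univ := suppDomOfRecord_top ν hM₁pos K hk htop
  -- the datum: `V` at scale `k`, `1` elsewhere
  obtain ⟨W, hWk⟩ : ∃ W : MSField (F.P K) (SU N), W k = V := ⟨Function.update (fun j => (1 : GaugeField (F.P K) j (SU N))) k V, Function.update_self _ _ _⟩
  -- the class at the top index is `𝔘_k(ε₀)`
  have hcls : {U : GaugeField (F.P K) 0 (SU N) | (∀ n, n ≤ k → PlaqSmallOn (Sect2.omegaPlaqsTop s.Ω Set.univ n) (ε₀ * (F.P K).eta n ^ 2) U) ∧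
      Sect2.CoDivClassOnTop s.Ω Set.univ k ε₀ U} = {U | InUkClassB11 F N K k ε₀ U} := by
    rw [setOf_inUkClassB11_eq K k hε0]
    exact Set.ext fun U => mem_classTop_iff K htop hε0 U
  have hgen : ∀ U₀ : GaugeField (F.P K) 0 (SU N),
      IsMinimizer (avOfRecord F N K) {U | InUkClassB11 F N K k ε₀ U} (genSet s.Ω k) W U₀ ↔ IsBackground (avOfRecord F N K) {U | InUkClassB11 F N K k ε₀ U} k V U₀ := fun U₀ => by
    rw [isMinimizer_genSet_top_iff (avOfRecord F N K) _ s.Ω hk htop W U₀, hWk]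
  -- the text at the top index
  have h := hEU ν (F.L ^ c₁) (fun _ => 0) K k s (by omega) hsep hM₁pos hadm ε₀ (fun _ => δ)
    (fun n _ => ⟨hδ, hδa, hBδ⟩) (fun n _ => by linarith) (fun n _ => by linarith) hε W
    (by simp only [hsup]; exact dataSmall7PTop_top K hk htop (by rw [hWk]; exact hV))
  simp only [hsup] at h
  rw [hcls] at h
  obtain ⟨⟨U₀, hU₀⟩, huniq⟩ := h
  refine ⟨⟨U₀, (hgen U₀).1 hU₀⟩, fun U₁ U₂ h₁ h₂ => ?_⟩
  obtain ⟨u, hu, rfl⟩ := huniq U₁ U₂ ((hgen U₁).2 h₁) ((hgen U₂).2 h₂)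
  refine orbitRel_of_towerCentral u U₁ fun b => hu k le_rfl b ?_
  rw [genSet_eq_atScale_of_top s.Ω hk htop]
  simp [atScale, B8Eq17ClassAkV1.bondsOf_univ]

/-! ## §4  n07-a's Theorem-1-at-objects slot from the two texts -/

/-- ★★★★ **n07-a's `hT1` AT A MEMBER INSIDE THE LEVEL GUARD, FROM THE (8)-TEXT AND THE EU-TEXT** — VERBATIM the per-member body of `B11Thm1CarrierT.objects_of_thm1Printed` that dag-n21-c's
`plaqSmall_minimiser_of_thm1_objects`, dag-n09-w1's `…HierarchyBindersOfLevelwiseThm1` and this seat's doors display (ceilings `a₀ a₁`, constant `B₃`): for `0 < ε₁ ≤ a₁` and a `ε₁`-regular `V`,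
(8) a minimiser over `𝔘_k(B₃ε₁)` exists (EU-text at `ε₀ := B₃ε₁`), and (6) for `B₃ε₁ ≤ ε₀ ≤ a₀` every minimiser `U` over `𝔘_k(B₃ε₁)` and every minimiser `U′` over `𝔘_k(ε₀)` satisfy
`U ∈ 𝔘_k(ε₀)` (monotonicity) and `OrbitRel k U U′` — `U′ ∈ 𝔘_k(B₃ε₁)` by the (8)-socket, so `A(U) = A(U′)`, `U` minimises over `𝔘_k(ε₀)` too, and the EU-text's uniqueness at `ε₀` applies.
CONDITIONAL on both texts; needs `B₃a₁ ≤ a₀`-free bookkeeping only (`B₃ε₁ ≤ a₀` is implied by the clause's own `B₃ε₁ ≤ ε₀ ≤ a₀`; for (8) we ask `B₃ε₁ ≤ a₀` explicitly). Nothing of Bałaban's asserted.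
[cite: Balaban1985Variational, Thm 1 (6),(8)–(10) pp.278–279; Balaban1987RG1, (1.1)–(1.2) p.260, (0.21) p.256; Balaban1988Convergent, (2.12) p.256] -/
theorem thm1Objects_of_texts {c c₀ c₁ : ℕ} {B₃ a₀ a₁ : ℝ} (hB₃ : 0 ≤ B₃)
    (h15 : VariationalThm1RegSepCoP7MGB F N
      (fun ν M g K k _s => c ≤ ν.M₁ ∧ k + c₀ ≤ F.m + K ∧ F.L ^ c₁ ∣ M ∧
        ∀ i, 1 ≤ i → i ≤ k → dCubeSide (F.P K).L M (RkOfRecord (F.P K).L ν.r (g i)) i ∣ (F.P K).sitesPerDir 0) (lamDatum F) (dataSmall7LamTopOf F N) B₃ a₀ a₁)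
    (hEU : VariationalThm1EUSepCoP7MG F N
      (fun ν M g K k _s => c ≤ ν.M₁ ∧ k + c₀ ≤ F.m + K ∧ F.L ^ c₁ ∣ M ∧
        ∀ i, 1 ≤ i → i ≤ k → dCubeSide (F.P K).L M (RkOfRecord (F.P K).L ν.r (g i)) i ∣ (F.P K).sitesPerDir 0) B₃ a₀ a₁)
    {K k : ℕ} (hk : 1 ≤ k) (hc₀ : k + c₀ ≤ F.m + K) (hc₁ : k + c₁ ≤ F.m + K) :
    ∀ ε₁ : ℝ, 0 < ε₁ → ε₁ ≤ a₁ → B₃ * ε₁ ≤ a₀ → ∀ V : GaugeField (F.P K) k (SU N), PlaqSmall ε₁ V →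
      (∃ U : GaugeField (F.P K) 0 (SU N), IsBackground (avOfRecord F N K) {U | InUkClassB11 F N K k (B₃ * ε₁) U} k V U) ∧
      (∀ ε₀ : ℝ, B₃ * ε₁ ≤ ε₀ → ε₀ ≤ a₀ → ∀ U U' : GaugeField (F.P K) 0 (SU N),
          IsBackground (avOfRecord F N K) {U | InUkClassB11 F N K k (B₃ * ε₁) U} k V U →
          IsBackground (avOfRecord F N K) {U | InUkClassB11 F N K k ε₀ U} k V U' → InUkClassB11 F N K k ε₀ U ∧ OrbitRel k U U') := by
  intro ε₁ hε₁ hε₁a hBa V hV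
  refine ⟨(exists_unique_isBackground_inUkClassB11_of_thm1EUSepCoP7MG F N hB₃ hEU hk hc₀ hc₁ hε₁ hε₁a le_rfl hBa hV).1, fun ε₀ hlo hhi U U' hU hU' => ?_⟩
  have hUε₀ : InUkClassB11 F N K k ε₀ U := inUkClassB11_mono hlo hU.2.1
  -- `U′` is `B₃ε₁`-regular by the (8)-socket, hence a competitor of `U`'s problem; so `U` minimises over `𝔘_k(ε₀)` too
  have hU'reg : InUkClassB11 F N K k (B₃ * ε₁) U' :=
    (plaqSmall_of_isBackground_inUkClassB11_of_thm1RegSepCoP7MGB F N hB₃ h15 hk hc₀ hc₁ hε₁ hε₁a hlo hhi hV hU').2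
  have hle : wilsonAction4 U ≤ wilsonAction4 U' := hU.2.2 U' hU'reg hU'.1
  have hUbig : IsBackground (avOfRecord F N K) {U | InUkClassB11 F N K k ε₀ U} k V U :=
    ⟨hU.1, hUε₀, fun U₂ hU₂ hU₂V => hle.trans (hU'.2.2 U₂ hU₂ hU₂V)⟩
  exact ⟨hUε₀, (exists_unique_isBackground_inUkClassB11_of_thm1EUSepCoP7MG F N hB₃ hEU hk hc₀ hc₁ hε₁ hε₁a hlo hhi hV).2 U U' hUbig hU'⟩

/-! ## §5  `N = 2`: inside the S1c witness's guard `hT1` costs the EU text alone -/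

/-- ★★★ **`hT1` AT `N = 2` INSIDE THE LEVEL GUARD FROM N12's EU TEXT ALONE** — the (8)-text is dag-n07-e's ✓p767981 + 53′ (file 5 §7's constants `c₀ c₁ B₃ ā a₁`); the EU text is asked
at the SAME guard and letters (antitone bookkeeping is the caller's).  Scope: deep levels only (`c₀ ≥ m + 48`); N07 NOT discharged. [cite: Balaban1985Variational, Thm 1 (6),(8)–(10) pp.278–279, Prop. 8 p.304; Balaban1988Convergent, (2.12) p.256] -/
theorem thm1Objects_of_thm1EU_SU2 (F : T4Family) :
    ∃ (c c₀ c₁ : ℕ) (B₃ ā a₁ : ℝ), 2 * (F.L : ℝ) ^ 2 ≤ B₃ ∧ 0 < ā ∧ 0 < a₁ ∧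
      (VariationalThm1EUSepCoP7MG F 2
        (fun ν M g K k _s => c ≤ ν.M₁ ∧ k + c₀ ≤ F.m + K ∧ F.L ^ c₁ ∣ M ∧
          ∀ i, 1 ≤ i → i ≤ k → dCubeSide (F.P K).L M (RkOfRecord (F.P K).L ν.r (g i)) i ∣ (F.P K).sitesPerDir 0) B₃ ā a₁ →
      ∀ (K k : ℕ), 1 ≤ k → k + c₀ ≤ F.m + K → k + c₁ ≤ F.m + K →
        ∀ ε₁ : ℝ, 0 < ε₁ → ε₁ ≤ a₁ → B₃ * ε₁ ≤ ā → ∀ V : GaugeField (F.P K) k (SU 2), PlaqSmall ε₁ V →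
          (∃ U : GaugeField (F.P K) 0 (SU 2), IsBackground (avOfRecord F 2 K) {U | InUkClassB11 F 2 K k (B₃ * ε₁) U} k V U) ∧
          (∀ ε₀ : ℝ, B₃ * ε₁ ≤ ε₀ → ε₀ ≤ ā → ∀ U U' : GaugeField (F.P K) 0 (SU 2),
              IsBackground (avOfRecord F 2 K) {U | InUkClassB11 F 2 K k (B₃ * ε₁) U} k V U →
              IsBackground (avOfRecord F 2 K) {U | InUkClassB11 F 2 K k ε₀ U} k V U' → InUkClassB11 F 2 K k ε₀ U ∧ OrbitRel k U U')) := by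
  obtain ⟨c, c₀, c₁, B₃, ā, a₁, hB₃, hā, ha₁, h8⟩ := K0Stub1BHolds.prop8StepCoPGridGBAt_holds F
  have hL : (0 : ℝ) < (F.L : ℝ) := by exact_mod_cast lt_trans Nat.zero_lt_one F.hL.2
  have hBpos : (0 : ℝ) < B₃ := lt_of_lt_of_le (mul_pos two_pos (pow_pos hL 2)) hB₃
  have h15 := N07Thm1Top7FromProp8GuardedB.variationalThm1RegSepCoP7MGB_of_prop8TopStepGB_lamDatum hBpos h8
  exact ⟨c, c₀, c₁, B₃, ā, a₁, hB₃, hā, ha₁, fun hEU K k hk hc₀ hc₁ => thm1Objects_of_texts F 2 hBpos.le h15 hEU hk hc₀ hc₁⟩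

end Socket

end Summit.QuantumFields.YangMills.BalabanUVNodes.K0TopSocketOfThm1EUText
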